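import Summits.BirchSwinnertonDyer.BirchSwinnertonDyer.Theorems.ErratumRoadFiveSelmerDefectAssembly
import Literature.NumberTheory.EllipticCurves.IwasawaEulerCharDualityProofs
import HarnessLib

/-!
# Route `ErratumRoadFive` (K2, `p ≥ 5`), crux (T) `Rest3TorsionBranchAtFive` (item
# stmt-BirchSwinnertonDyer-19702): THEOREM T♭, the GENERATOR BOUND (G2) — the dual control defect at a
# single constrained place is finite of order `≤ #H⁰(K_𝔭, M_{g_m})`, hence generated by `≤ B` elements
# uniformly in `m`; and T♭ one-sided, kernel form, with (G2) DISCHARGED from «`H⁰(K_𝔭, M_{g_m})` finite of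
# bounded order» (memo §31.2 (E)(g), §32.8–32.9)

Cell `bsd-stepL` (run/shared/lean/pub/bsd-stepL/), seat `bsd-stepL-bdp` (prover g14, 2026-08-26);
`--supports stmt-BirchSwinnertonDyer-19702 --as helper`. Sequel of `ErratumRoadFiveSelmerDefectAssembly.lean`
(T♭ one-sided at the Selmer level, with the residual hypothesis `hgen` = (G2)).

HONEST FRAMING: theorems only (no definition, no named fact, no `sorry`); PURE ALGEBRA on abstract Selmer
data (multr1-p1's `ContinuousRep`/`selmer` currency); the arithmetic objects and the erratum's inputs are
NOT constructed or asserted; nothing is booked; no census word, tier or label moves (T7).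

## What and why

(G2) asked for a bound, uniform in `m`, on the number of generators of `Kd_m = C_m^∨`, `C_m` the cokernel
of `j_m : Sel(M_{g_m}[a^m]) ↪ Sel(M_{g_m})[a^m]`. At a SINGLE constrained place `v₀` (the erratum's
`Sel^Σ_𝔭`: constrained at `𝔭` only, the `Σ`-places relaxed) there is a CANONICAL injection
`C_m ↪ H¹(Γ_{v₀}, M_{g_m}[a^m])` landing in `im δ₀^{(v₀)} ≅ M_{g_m}^{Γ_{v₀}}/a^m` — the unique lift (global
invariants vanish) followed by restriction —, so `#C_m ≤ #M_{g_m}^{Γ_{v₀}}`; Pontryagin duality preserves the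
order of a finite group (`PontryaginCard.natCard_characterModule`, tree), and a finite module of order `≤ B`
is generated by `≤ B` elements (all of them). In T♭: `#M_{g_m}^{Γ_𝔭} = #H⁰(K_𝔭, M_{g_m}) = p^{c₀}` for `m > ek`
(memo §31.2 (g) + (L1)), uniformly — so (G2) holds with `n = p^{c₀}` (crude but uniform, which is all the
bounded congruence limit needs).

* `exists_fin_span_eq_top_of_natCard_le` — a finite module with `Nat.card ≤ B` is spanned by a `Fin B`-family.
* `natCard_defect_le` — `#(Sel(M)[r]/j(Sel(M[r]))) ≤ #M^{Γ_{v₀}}` (single place, global invariants `r`-divisible,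
  `M^{Γ_{v₀}}` finite), with finiteness of the defect; `exists_fin_span_dual_defect` — its dual is spanned by
  `B` elements whenever `#M^{Γ_{v₀}} ≤ B`.
* `powerSeries_charIdeal_le_of_selmer_congruences_finite_localInvariants` — **T♭ one-sided, kernel form, (G2)
  discharged**: as `…boundedDefect` (file `…SelmerDefectAssembly`) with `L₀ = {v₀}` and `hgen` replaced by
  «`M_{g_m}^{Γ_{v₀}}` finite with `Nat.card ≤ B` for all `m`».

References: [Castella2018Erratum] Lemma 2.1, proof of Thm. 1.1 (p. 4); memo PROOF-BDP §31.2–31.3, §32.8–32.9.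
-/

set_option autoImplicit false
-- the Theorems namespace of this sub repeats the summit name by design (D-0017 nested layout)
set_option linter.dupNamespace false

noncomputable section

open CategoryTheory CharacterModule Literature.NumberTheory.GaloisRepresentations
  Literature.RingTheory.FittingIdeal Literature.NumberTheory.EllipticCurves
  Literature.NumberTheory.EllipticCurves.Module
  Summit.BirchSwinnertonDyer.Rank1Residual.X11b.TorsionControl
  Summit.BirchSwinnertonDyer.Rank1Residual.X11b
  Summit.BirchSwinnertonDyer.BirchSwinnertonDyer.Theorems.SelmerControlDefect
  Summit.BirchSwinnertonDyer.BirchSwinnertonDyer.Theorems.SelmerDefectAssembly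
open scoped ContRepresentation

namespace Summit.BirchSwinnertonDyer.BirchSwinnertonDyer.Theorems.SelmerDefectGenerators

universe u

/-! ### §1 A finite module of bounded order has a bounded spanning family -/

/-- A finite `R`-module `K` with `Nat.card K ≤ B` is spanned by a family indexed by `Fin B` (enumerate all
elements and pad with `0`). This is the (crude, but UNIFORM) generator bound the bounded congruence limit
needs. [folklore] -/
theorem exists_fin_span_eq_top_of_natCard_le {R : Type*} [Ring R] {K : Type*} [AddCommGroup K]
    [Module R K] [Finite K] {B : ℕ} (hB : Nat.card K ≤ B) :
    ∃ κ : Fin B → K, Submodule.span R (Set.range κ) = ⊤ := by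
  haveI : Nonempty K := ⟨0⟩
  have hc : Nat.card K ≠ 0 := Nat.card_pos.ne'
  let e : K ≃ Fin (Nat.card K) := Nat.equivFinOfCardPos hc
  refine ⟨fun i => if h : (i : ℕ) < Nat.card K then e.symm ⟨i, h⟩ else 0, ?_⟩
  refine Submodule.eq_top_iff'.mpr fun x => Submodule.subset_span ⟨⟨e x, (e x).2.trans_le hB⟩, ?_⟩
  simp only [Fin.is_lt, ↓reduceDIte, Fin.eta, Equiv.symm_apply_apply]

/-! ### §2 The order of the control defect at a single constrained place -/

section Defect

variable {A : Type*} [CommRing A] [TopologicalSpace A]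
variable {Γ : Type u} [Group Γ] [TopologicalSpace Γ] [IsTopologicalGroup Γ]
variable {M : Type u} [AddCommGroup M] [Module A M] [TopologicalSpace M] [DiscreteTopology M]
  [ContinuousSMul A M]
variable {ι : Type*} {Γv : ι → Type u} [∀ v, Group (Γv v)] [∀ v, TopologicalSpace (Γv v)]
  [∀ v, IsTopologicalGroup (Γv v)] (φ : ∀ v, Γv v →ₜ* Γ) (v₀ : ι)
variable (ρ : ContinuousRep Γ A M) (r : A)

/-- **`#(Sel(M)[r] / j(Sel(M[r]))) ≤ #M^{Γ_{v₀}}`, and the defect is finite** — at a SINGLE constrained place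
`v₀`, for `r`-divisible `M` with `r`-divisible global invariants and FINITE local invariants `M^{Γ_{v₀}}`. The
canonical map: `s ↦ res_{v₀}(x(s))`, `x(s)` the unique lift of `s` to `H¹(Γ, M[r])` (`torsionH1Equiv`); it
kills exactly `j(Sel(M[r]))` and lands in `im δ₀^{(v₀)}`, a quotient of `M^{Γ_{v₀}}`.
[cite: Castella2018Erratum, Lemma 2.1] -/
theorem natCard_defect_le (hr : Function.Surjective fun m : M => r • m)
    (h0 : ρ.toTopRep.ρ.invariants = ⊥) [Finite ((ρ.restrict (φ v₀)).toTopRep).ρ.invariants] :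
    Finite (↥(Submodule.torsionBy A ↥(selmer φ {v₀} ρ) r) ⧸
        Submodule.comap ((selmer φ {v₀} ρ).subtype ∘ₗ (Submodule.torsionBy A ↥(selmer φ {v₀} ρ) r).subtype)
          (Submodule.map (torsionInclH1 ρ r) (selmer φ {v₀} (torsionRep ρ r)))) ∧
      Nat.card (↥(Submodule.torsionBy A ↥(selmer φ {v₀} ρ) r) ⧸
        Submodule.comap ((selmer φ {v₀} ρ).subtype ∘ₗ (Submodule.torsionBy A ↥(selmer φ {v₀} ρ) r).subtype)
          (Submodule.map (torsionInclH1 ρ r) (selmer φ {v₀} (torsionRep ρ r)))) ≤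
        Nat.card ((ρ.restrict (φ v₀)).toTopRep).ρ.invariants := by
  have hdiv := invariants_divisible_of_eq_bot ρ r h0
  -- abbreviations (local)
  set S : Submodule A ↥(selmer φ {v₀} ρ) := Submodule.torsionBy A ↥(selmer φ {v₀} ρ) r with hS
  set U : Submodule A ↥S := Submodule.comap ((selmer φ {v₀} ρ).subtype ∘ₗ S.subtype)
      (Submodule.map (torsionInclH1 ρ r) (selmer φ {v₀} (torsionRep ρ r))) with hU
  -- the unique lift `x(s) ∈ H¹(Γ, M[r])` of `s`, linearly in `s`
  let e := torsionH1Equiv ρ r hr hdiv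
  let toTors : ↥S →ₗ[A] ↥(Submodule.torsionBy A (continuousCohomology 1 ρ.toTopRep) r) :=
    { toFun := fun s => ⟨((s : ↥(selmer φ {v₀} ρ)) : continuousCohomology 1 ρ.toTopRep),
        (Submodule.mem_torsionBy_iff r _).2
          (congrArg Subtype.val ((Submodule.mem_torsionBy_iff r (s : ↥(selmer φ {v₀} ρ))).1 s.2))⟩
      map_add' := fun _ _ => rfl
      map_smul' := fun _ _ => rfl }
  let lift : ↥S →ₗ[A] continuousCohomology 1 (torsionRep ρ r).toTopRep := e.symm.toLinearMap ∘ₗ toTors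
  have hlift : ∀ s : ↥S, torsionInclH1 ρ r (lift s) =
      ((s : ↥(selmer φ {v₀} ρ)) : continuousCohomology 1 ρ.toTopRep) := by
    intro s
    have := torsionH1Equiv_apply_coe ρ r hr hdiv (e.symm (toTors s))
    rw [LinearEquiv.apply_symm_apply] at this
    exact this.symm
  -- the defect map `g : s ↦ res_{v₀} (x(s))`
  let res : continuousCohomology 1 (torsionRep ρ r).toTopRep →ₗ[A]
      continuousCohomology 1 ((torsionRep ρ r).restrict (φ v₀)).toTopRep :=
    (resH1 (torsionRep ρ r) (φ v₀)).hom.toLinearMap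
  let g : ↥S →ₗ[A] continuousCohomology 1 ((torsionRep ρ r).restrict (φ v₀)).toTopRep := res ∘ₗ lift
  -- `g` kills exactly `U`
  have hker : ∀ s : ↥S, g s = 0 ↔ s ∈ U := by
    intro s
    have hsSel : ((s : ↥(selmer φ {v₀} ρ)) : continuousCohomology 1 ρ.toTopRep) ∈ selmer φ {v₀} ρ :=
      (s : ↥(selmer φ {v₀} ρ)).2
    have key := mem_map_selmer_iff_forall_res_eq_zero φ {v₀} ρ r hr hdiv (lift s) (hlift s)
    constructor
    · intro hg
      have hmem := key.mpr (fun v hv => by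
        rw [Set.mem_singleton_iff] at hv
        subst hv
        exact hg)
      exact hmem
    · intro hs
      exact (key.mp hs) v₀ (Set.mem_singleton v₀)
  have hUker : U ≤ LinearMap.ker g := fun s hs => (hker s).mpr hs
  let gq : (↥S ⧸ U) →ₗ[A] continuousCohomology 1 ((torsionRep ρ r).restrict (φ v₀)).toTopRep :=
    U.liftQ g hUker
  have hgq_inj : Function.Injective gq := by
    rw [← LinearMap.ker_eq_bot, Submodule.eq_bot_iff]
    intro q hq
    obtain ⟨s, rfl⟩ := Submodule.mkQ_surjective U q
    rw [LinearMap.mem_ker, Submodule.mkQ_apply, Submodule.liftQ_apply] at hq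
    exact (Submodule.Quotient.mk_eq_zero U).mpr ((hker s).mp hq)
  -- `g` lands in the image of `δ₀^{(v₀)} : M^{Γ_{v₀}} → H¹(Γ_{v₀}, M[r])`
  let δ : ↥((ρ.restrict (φ v₀)).toTopRep).ρ.invariants →ₗ[A]
      continuousCohomology 1 ((torsionRep ρ r).restrict (φ v₀)).toTopRep :=
    (isSES_torsion (ρ.restrict (φ v₀)) r hr).δ₀
  have hrange : ∀ s : ↥S, g s ∈ LinearMap.range δ := by
    intro s
    obtain ⟨x, hx, hloc⟩ := exists_lift_with_local_defect φ {v₀} ρ r hr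
      (y := ((s : ↥(selmer φ {v₀} ρ)) : continuousCohomology 1 ρ.toTopRep)) (s : ↥(selmer φ {v₀} ρ)).2
      (congrArg Subtype.val ((Submodule.mem_torsionBy_iff r (s : ↥(selmer φ {v₀} ρ))).1 s.2))
    have hxe : x = lift s :=
      cohomologyMap_torsionIncl_injective ρ r hr hdiv (hx.trans (hlift s).symm)
    obtain ⟨w, hw⟩ := hloc v₀ (Set.mem_singleton v₀)
    refine ⟨w, ?_⟩
    rw [hxe] at hw
    exact hw
  -- counting
  haveI : Finite ↥(LinearMap.range δ) :=
    Finite.of_surjective (LinearMap.rangeRestrict δ) (LinearMap.surjective_rangeRestrict δ)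
  let gq' : (↥S ⧸ U) → ↥(LinearMap.range δ) := fun q => ⟨gq q, by
    obtain ⟨s, rfl⟩ := Submodule.mkQ_surjective U q
    rw [Submodule.mkQ_apply, Submodule.liftQ_apply]
    exact hrange s⟩
  have hgq'_inj : Function.Injective gq' := fun q q' h => hgq_inj (congrArg Subtype.val h)
  haveI hfin : Finite (↥S ⧸ U) := Finite.of_injective gq' hgq'_inj
  refine ⟨hfin, (Nat.card_le_card_of_injective gq' hgq'_inj).trans ?_⟩
  exact Nat.card_le_card_of_surjective (LinearMap.rangeRestrict δ) (LinearMap.surjective_rangeRestrict δ)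

/-- **(G2): the dual defect is spanned by `B` elements, uniformly**, whenever `#M^{Γ_{v₀}} ≤ B`: the
Pontryagin dual of the (finite) defect has the same order (`PontryaginCard.natCard_characterModule`), and a
finite module of order `≤ B` is spanned by a `Fin B`-family. [cite: Castella2018Erratum, Lemma 2.1] -/
theorem exists_fin_span_dual_defect (hr : Function.Surjective fun m : M => r • m)
    (h0 : ρ.toTopRep.ρ.invariants = ⊥) [Finite ((ρ.restrict (φ v₀)).toTopRep).ρ.invariants] {B : ℕ}
    (hB : Nat.card ((ρ.restrict (φ v₀)).toTopRep).ρ.invariants ≤ B) :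
    ∃ κ : Fin B → CharacterModule (↥(Submodule.torsionBy A ↥(selmer φ {v₀} ρ) r) ⧸
        Submodule.comap ((selmer φ {v₀} ρ).subtype ∘ₗ (Submodule.torsionBy A ↥(selmer φ {v₀} ρ) r).subtype)
          (Submodule.map (torsionInclH1 ρ r) (selmer φ {v₀} (torsionRep ρ r)))),
      Submodule.span A (Set.range κ) = ⊤ := by
  obtain ⟨hfin, hcard⟩ := natCard_defect_le φ v₀ ρ r hr h0
  haveI := hfin
  haveI := PontryaginCard.finite_characterModule_of_finite
    (↥(Submodule.torsionBy A ↥(selmer φ {v₀} ρ) r) ⧸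
      Submodule.comap ((selmer φ {v₀} ρ).subtype ∘ₗ (Submodule.torsionBy A ↥(selmer φ {v₀} ρ) r).subtype)
        (Submodule.map (torsionInclH1 ρ r) (selmer φ {v₀} (torsionRep ρ r))))
  refine exists_fin_span_eq_top_of_natCard_le ?_
  rw [PontryaginCard.natCard_characterModule]
  exact hcard.trans hB

end Defect

/-! ### §3 T♭ one-sided, kernel form, with (G2) discharged -/

section Assembly

variable {𝒪 : Type} [CommRing 𝒪] [IsDomain 𝒪] [IsDiscreteValuationRing 𝒪]
  [IsAdicComplete (IsLocalRing.maximalIdeal 𝒪) 𝒪] [TopologicalSpace (PowerSeries 𝒪)]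
variable {Γ₀ : Type} [Group Γ₀] [TopologicalSpace Γ₀] [IsTopologicalGroup Γ₀]
variable {ι₀ : Type*} {Γw : ι₀ → Type} [∀ v, Group (Γw v)] [∀ v, TopologicalSpace (Γw v)]
  [∀ v, IsTopologicalGroup (Γw v)] (ψ : ∀ v, Γw v →ₜ* Γ₀) (v₀ : ι₀)

/-- **THEOREM T♭ (erratum Thm. 1.1 WITHOUT (iv)), one-sided, kernel form — (G2) discharged.** As
`SelmerDefectAssembly.powerSeries_charIdeal_le_of_selmer_congruences_boundedDefect` with a single constrained
place `v₀` (the erratum's `Sel_𝔭`), the generator hypothesis `hgen` replaced by: the local invariants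
`M_{g_m}^{Γ_{v₀}}` are FINITE with `Nat.card ≤ B` for all `m` (memo §31.2 (E)(g): `= 𝒪/p^k`-shaped of order
`p^{c₀}`, uniformly, by (L1) and the exponent descent). Conclusion: **`Fitt_Λ(X) = Ch_Λ(X) ⊆ (L)`** for
`X = Sel(M_f)^∨`. Remaining inputs are exactly the erratum's own (objects, (a)(b)(c), Thm. 2.3 ⇐ FW21 4.41,
Lemma 2.2, control) plus `π ∤ L` (§31.3 (7)); NO `E(ℚ_p)[p] = 0`.
[cite: Castella2018Erratum, proof of Thm. 1.1 (p. 4), read one-sidedly and without (iv)] -/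
theorem powerSeries_charIdeal_le_of_selmer_congruences_finite_localInvariants
    (a : PowerSeries 𝒪) (ha : Ideal.span {a} ≤ (⊥ : Ideal (PowerSeries 𝒪)).jacobson)
    {Mf : Type} [AddCommGroup Mf] [Module (PowerSeries 𝒪) Mf] [TopologicalSpace Mf]
    [DiscreteTopology Mf] [ContinuousSMul (PowerSeries 𝒪) Mf] (ρf : ContinuousRep Γ₀ (PowerSeries 𝒪) Mf)
    (hdivf : Function.Surjective fun x : Mf => a • x) (h0f : ρf.toTopRep.ρ.invariants = ⊥)
    (Mg : ℕ → Type) [∀ m, AddCommGroup (Mg m)] [∀ m, Module (PowerSeries 𝒪) (Mg m)]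
    [∀ m, TopologicalSpace (Mg m)] [∀ m, DiscreteTopology (Mg m)]
    [∀ m, ContinuousSMul (PowerSeries 𝒪) (Mg m)] (ρg : ∀ m, ContinuousRep Γ₀ (PowerSeries 𝒪) (Mg m))
    (hdivg : ∀ m, Function.Surjective fun x : Mg m => a • x)
    (h0g : ∀ m, (ρg m).toTopRep.ρ.invariants = ⊥)
    (θ : ∀ m, 1 ≤ m → ((torsionRep (ρg m) (a ^ m)).toTopRep ≅ (torsionRep ρf (a ^ m)).toTopRep))
    [Module.Finite (PowerSeries 𝒪) (CharacterModule (selmer ψ {v₀} ρf))]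
    [∀ m, Module.Finite (PowerSeries 𝒪) (CharacterModule (selmer ψ {v₀} (ρg m)))]
    [∀ m, Finite (((ρg m).restrict (ψ v₀)).toTopRep).ρ.invariants]
    {π L : PowerSeries 𝒪} (hπ : Prime π) (hL : ¬ π ∣ L) (k B : ℕ) (Lm : ℕ → PowerSeries 𝒪)
    (hkillg : ∀ m, ∀ w : Mg m, w ∈ (((ρg m).restrict (ψ v₀)).toTopRep).ρ.invariants → π ^ k • w = 0)
    (hB : ∀ m, Nat.card (((ρg m).restrict (ψ v₀)).toTopRep).ρ.invariants ≤ B)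
    (hCh : ∀ m, 1 ≤ m → Module.IsTorsion (PowerSeries 𝒪) (CharacterModule (selmer ψ {v₀} (ρg m))) →
      charIdeal (PowerSeries 𝒪) (CharacterModule (selmer ψ {v₀} (ρg m))) ≤ Ideal.span {Lm m})
    (hc : ∀ m, 1 ≤ m → Ideal.span {Lm m} ⊔ (Ideal.span {a}) ^ m = Ideal.span {L} ⊔ (Ideal.span {a}) ^ m)
    (hT : Module.IsTorsion (PowerSeries 𝒪) (CharacterModule (selmer ψ {v₀} ρf)))
    (hnf : ∀ N' : Submodule (PowerSeries 𝒪) (CharacterModule (selmer ψ {v₀} ρf)),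
      Module.length (PowerSeries 𝒪) N' ≠ ⊤ → N' = ⊥) :
    Module.fittingIdeal (PowerSeries 𝒪) (CharacterModule (selmer ψ {v₀} ρf)) 0 =
        charIdeal (PowerSeries 𝒪) (CharacterModule (selmer ψ {v₀} ρf)) ∧
      charIdeal (PowerSeries 𝒪) (CharacterModule (selmer ψ {v₀} ρf)) ≤ Ideal.span {L} :=
  powerSeries_charIdeal_le_of_selmer_congruences_boundedDefect ψ {v₀} a ha ρf hdivf h0f Mg ρg hdivg h0g θ
    hπ hL k B Lm (fun m v hv w hw => by
      rw [Set.mem_singleton_iff] at hv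
      subst hv
      exact hkillg m w hw)
    (fun m _ => exists_fin_span_dual_defect ψ v₀ (ρg m) (a ^ m) (surjective_pow_smul a (hdivg m) m)
      (h0g m) (hB m))
    hCh hc hT hnf

end Assembly

end Summit.BirchSwinnertonDyer.BirchSwinnertonDyer.Theorems.SelmerDefectGenerators

end
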